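import Mathlib
import HarnessLib
import Summits.HubbardSuperconductivity.HubbardSuperconductivity.Theorems.KLProgrammeKLRegimeThinMultiplierIncrementPairSpace
import Summits.HubbardSuperconductivity.HubbardSuperconductivity.Theorems.KLProgrammeKLRegimeThinMultiplierIncrementPairSymbol
import Summits.HubbardSuperconductivity.HubbardSuperconductivity.Theorems.KLProgrammeKLRegimeFatMultiplierIncrementPairScaleIso

/-!
# K3 VL child `KLRegimeVolumeLimitV17F2` (stmt-HubbardSuperconductivity-20440), located item #23 «W2-HALF-VL», brick «W2H-OVL» part 9 (SCALE, iso): the THIN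
# increment pair `(F^{K_o}_{n_a,ω_a} − F^{K}_{n_a,ω_a})·F^{K}_{n_b,ω_b}` has space differences in RELATIVE SCALE FORM along every admissible integer step

Cell `gate-hubbard-kl`, seat p3 (g14), lead of #23; THIN twin of k3c3-p2's `…FatMultiplierIncrementPairScaleIso` (p594699):
`norm_fwdDiff_iter_space_thinIncrPair_le` (T1, exact Leibniz brackets, isotropic slot `(4+2A)‖w‖`) ∘ `thinIncr_cofactor_scale_le` (§1, the thin co-factor's
jets in scale form: two angular widths, no neighbour count) ∘ k3c3-p2's `incrPair_space_rel_scale_le` (`…IncrementRelJetsScale`): in the two-scale class of a flow piece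
at depth `x ≥ 1` (`|ν| ≤ G₀/x²`, `‖Dν‖ ≤ G₁/x`, `‖D²ν‖ ≤ G₂`, `‖D³ν‖ ≤ G₃x`, `4 + 8A₃ ≤ ε₃₀ + ε₃₁x`, `G₀/x² ≤ Λ_a`), `η = ‖toLp w‖` the Euclidean step norm,

* §1 `thinIncr_cofactor_scale_le` — `q_k ≤ η^k𝔮_k` (pure real algebra);
* §2 **`norm_fwdDiff_iter_thinIncrPair_scaleIso_le`** — `‖Δ_u^k Gs^Δ(q)‖ ≤ 𝔅₀(x)·η^k·(r̃_{k0} + … + r̃_{kk}x^k)`, `k = 1, 2, 3`,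
  `𝔅₀(x) = C₁·(G₀/x²)(2(Λ_a + G₀/x²) + G₀/x²)` (`C₁ = de₀²/Λ_a²`, `Λ_a = klScale e₀ n_a`), coefficients nested-explicit (abbreviation hypotheses; iso slot
  `t = 4 + 2A`, angular size `ζ = (1 + 6/w_{n_a}) + (1 + 6/w_{n_b})`, co-factor scale `Λ_b = klScale e₀ n_b`), all nonnegative.

Everything is proved; no definitions, no sorry.  Nothing asserts any stub, K3, VL or superconductivity.
[cite: BenfattoGiulianiMastropietro2006, §2.5 Lemma 2.2 (2.53)–(2.55), §3 (3.2)–(3.8)]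
-/

noncomputable section

namespace Summit.HubbardSuperconductivity.HubbardSuperconductivity.Theorems.TorusFourierL2

set_option linter.dupNamespace false -- summit = problem name (single-conjunct summit), D-0017

open Set Finset Filter Topology Literature.MathematicalPhysics.QuantumLattice Literature.MathematicalPhysics.QuantumLattice.BandSectorCounting
open Literature.MathematicalPhysics.QuantumLattice.FermiRG Literature.Probability.LatticeModels Literature.Analysis.SpecialFunctions Literature.Analysis.Calculus
open Summit.HubbardSuperconductivity.HubbardSuperconductivity.Theorems.DispersionFlow
open Summit.HubbardSuperconductivity.HubbardSuperconductivity.Theorems.KLRegimeSplit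
open Summit.HubbardSuperconductivity.HubbardSuperconductivity.Theorems.KLProgrammeLegKernels
open Summit.HubbardSuperconductivity.HubbardSuperconductivity.Theorems.PerturbedFermiCurve
open scoped Real Nat

/-! ### §1 The thin co-factor's jets in scale form -/

set_option maxHeartbeats 800000 in
/-- **The THIN co-factor's localised line jets in scale form**: the `q₁, q₂, q₃` of `norm_fwdDiff_iter_space_thinIncrPair_le` /
`norm_fwdDiff_iter_tangent_thinIncrPair_le` (first band slot `τw`, step sup-norm `nw`, two angular sizes `zD₁, zD₂ ≤ ζη`) are `≤ η𝔮₁`, `≤ η²𝔮₂`,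
`≤ η³(𝔮₃₀ + 𝔮₃₁x)` with the 𝔮's of k3c3-p2's `incrPair_cofactor_scale_le` at neighbour count `1`, as soon as `τw ≤ tη`, `nw ≤ η`,
`4 + 8A₃ ≤ ε₃₀ + ε₃₁x`. [cite: BenfattoGiulianiMastropietro2006, §3 (3.2)] -/
theorem thinIncr_cofactor_scale_le {g₁ g₂ g₃ Λ Kp A₃ τw nw zD₁ zD₂ Ba z₁ z₂ z₃ q₁ q₂ q₃ t η ζ ε₃₀ ε₃₁ x 𝔮₁ 𝔮₂ 𝔮₃₀ 𝔮₃₁ : ℝ}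
    (hg₁ : 0 ≤ g₁) (hg₂ : 0 ≤ g₂) (hg₃ : 0 ≤ g₃) (hΛ : 0 < Λ) (hKp : 0 ≤ Kp) (hBa : 0 ≤ Ba)
    (hτ0 : 0 ≤ τw) (hnw0 : 0 ≤ nw) (hzD10 : 0 ≤ zD₁) (hzD20 : 0 ≤ zD₂) (ht : 0 ≤ t) (hζ : 0 ≤ ζ) (hε₃₀ : 0 ≤ ε₃₀) (hε₃₁ : 0 ≤ ε₃₁) (hx : 1 ≤ x)
    (hτ : τw ≤ t * η) (hnw : nw ≤ η) (hzD₁ : zD₁ ≤ ζ * η) (hzD₂ : zD₂ ≤ ζ * η) (hA₃x : 4 + 8 * A₃ ≤ ε₃₀ + ε₃₁ * x)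
    (hz₁ : z₁ = 6 * Ba * (zD₁ + zD₂)) (hz₂ : z₂ = 6 * Ba * (zD₁ ^ 2 + zD₂ ^ 2) + 72 * Ba ^ 2 * (zD₁ * zD₂))
    (hz₃ : z₃ = 6 * Ba * (zD₁ ^ 3 + zD₂ ^ 3) + 108 * Ba ^ 2 * (zD₁ ^ 2 * zD₂ + zD₁ * zD₂ ^ 2))
    (hq₁ : q₁ = 2 * g₁ * τw / Λ * 1 + 1 * z₁)
    (hq₂ : q₂ = ((4 * g₂ + 2 * g₁) * τw ^ 2 / Λ ^ 2 + 2 * g₁ * (Kp * nw ^ 2) / Λ) * 1 + 4 * g₁ * τw / Λ * z₁ + 1 * z₂)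
    (hq₃ : q₃ = ((8 * g₃ + 12 * g₂) * τw ^ 3 / Λ ^ 3 + (12 * g₂ + 6 * g₁) * (τw * (Kp * nw ^ 2)) / Λ ^ 2 + 2 * g₁ * ((4 + 8 * A₃) * nw ^ 3) / Λ) * 1 +
      3 * (((4 * g₂ + 2 * g₁) * τw ^ 2 / Λ ^ 2 + 2 * g₁ * (Kp * nw ^ 2) / Λ) * z₁) + 3 * (2 * g₁ * τw / Λ * z₂) + 1 * z₃)
    (h𝔮₁ : 𝔮₁ = 2 * g₁ * t / Λ + 1 * (12 * Ba * ζ))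
    (h𝔮₂ : 𝔮₂ = (4 * g₂ + 2 * g₁) * t ^ 2 / Λ ^ 2 + 2 * g₁ * Kp / Λ + 4 * g₁ * t / Λ * (1 * (12 * Ba * ζ)) + 1 * ((12 * Ba + 72 * Ba ^ 2) * ζ ^ 2))
    (h𝔮₃₀ : 𝔮₃₀ = (8 * g₃ + 12 * g₂) * t ^ 3 / Λ ^ 3 + (12 * g₂ + 6 * g₁) * (t * Kp) / Λ ^ 2 + 2 * g₁ * ε₃₀ / Λ +
      3 * (((4 * g₂ + 2 * g₁) * t ^ 2 / Λ ^ 2 + 2 * g₁ * Kp / Λ) * (1 * (12 * Ba * ζ))) + 3 * (2 * g₁ * t / Λ * (1 * ((12 * Ba + 72 * Ba ^ 2) * ζ ^ 2))) +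
      1 * ((12 * Ba + 216 * Ba ^ 2) * ζ ^ 3))
    (h𝔮₃₁ : 𝔮₃₁ = 2 * g₁ * ε₃₁ / Λ) :
    q₁ ≤ η * 𝔮₁ ∧ q₂ ≤ η ^ 2 * 𝔮₂ ∧ q₃ ≤ η ^ 3 * (𝔮₃₀ + 𝔮₃₁ * x) ∧ 0 ≤ 𝔮₁ ∧ 0 ≤ 𝔮₂ ∧ 0 ≤ 𝔮₃₀ ∧ 0 ≤ 𝔮₃₁ := by
  have hη : 0 ≤ η := hnw0.trans hnw
  have htη : 0 ≤ t * η := by positivity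
  have hζη : 0 ≤ ζ * η := by positivity
  have hx0 : 0 ≤ x := zero_le_one.trans hx
  -- powers of the slots
  have hτ2 : τw ^ 2 ≤ (t * η) ^ 2 := pow_le_pow_left₀ hτ0 hτ 2
  have hτ3 : τw ^ 3 ≤ (t * η) ^ 3 := pow_le_pow_left₀ hτ0 hτ 3
  have hn2 : nw ^ 2 ≤ η ^ 2 := pow_le_pow_left₀ hnw0 hnw 2
  have hn3 : nw ^ 3 ≤ η ^ 3 := pow_le_pow_left₀ hnw0 hnw 3
  have a12 : zD₁ ^ 2 ≤ (ζ * η) ^ 2 := pow_le_pow_left₀ hzD10 hzD₁ 2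
  have a22 : zD₂ ^ 2 ≤ (ζ * η) ^ 2 := pow_le_pow_left₀ hzD20 hzD₂ 2
  have a13 : zD₁ ^ 3 ≤ (ζ * η) ^ 3 := pow_le_pow_left₀ hzD10 hzD₁ 3
  have a23 : zD₂ ^ 3 ≤ (ζ * η) ^ 3 := pow_le_pow_left₀ hzD20 hzD₂ 3
  have a11 : zD₁ * zD₂ ≤ (ζ * η) * (ζ * η) := mul_le_mul hzD₁ hzD₂ hzD20 hζη
  have a21 : zD₁ ^ 2 * zD₂ ≤ (ζ * η) ^ 2 * (ζ * η) := mul_le_mul a12 hzD₂ hzD20 (by positivity)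
  have a31 : zD₁ * zD₂ ^ 2 ≤ (ζ * η) * (ζ * η) ^ 2 := mul_le_mul hzD₁ a22 (by positivity) hζη
  have hB2 : 0 ≤ Ba ^ 2 := sq_nonneg Ba
  have bz₁ : z₁ ≤ 1 * (12 * Ba * (ζ * η)) := by
    rw [hz₁]
    have h := add_le_add hzD₁ hzD₂
    have := mul_le_mul_of_nonneg_left h (show 0 ≤ 6 * Ba by positivity)
    linarith only [this]
  have bz₂ : z₂ ≤ 1 * ((12 * Ba + 72 * Ba ^ 2) * (ζ * η) ^ 2) := by
    rw [hz₂]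
    have h1 := mul_le_mul_of_nonneg_left (add_le_add a12 a22) (show 0 ≤ 6 * Ba by positivity)
    have h2 := mul_le_mul_of_nonneg_left a11 (show 0 ≤ 72 * Ba ^ 2 by positivity)
    linarith only [h1, h2]
  have bz₃ : z₃ ≤ 1 * ((12 * Ba + 216 * Ba ^ 2) * (ζ * η) ^ 3) := by
    rw [hz₃]
    have h1 := mul_le_mul_of_nonneg_left (add_le_add a13 a23) (show 0 ≤ 6 * Ba by positivity)
    have h2 := mul_le_mul_of_nonneg_left (add_le_add a21 a31) (show 0 ≤ 108 * Ba ^ 2 by positivity)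
    linarith only [h1, h2]
  have hz₁0 : 0 ≤ z₁ := by rw [hz₁]; positivity
  have hz₂0 : 0 ≤ z₂ := by rw [hz₂]; positivity
  -- the building blocks
  have a1 : 2 * g₁ * τw / Λ ≤ 2 * g₁ * (t * η) / Λ := by gcongr
  have a10 : 0 ≤ 2 * g₁ * τw / Λ := by positivity
  have a2 : (4 * g₂ + 2 * g₁) * τw ^ 2 / Λ ^ 2 ≤ (4 * g₂ + 2 * g₁) * (t * η) ^ 2 / Λ ^ 2 := by gcongr
  have a3 : 2 * g₁ * (Kp * nw ^ 2) / Λ ≤ 2 * g₁ * (Kp * η ^ 2) / Λ := by gcongr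
  have a23 : 0 ≤ (4 * g₂ + 2 * g₁) * τw ^ 2 / Λ ^ 2 + 2 * g₁ * (Kp * nw ^ 2) / Λ := by positivity
  have a4 : (8 * g₃ + 12 * g₂) * τw ^ 3 / Λ ^ 3 ≤ (8 * g₃ + 12 * g₂) * (t * η) ^ 3 / Λ ^ 3 := by gcongr
  have a5 : (12 * g₂ + 6 * g₁) * (τw * (Kp * nw ^ 2)) / Λ ^ 2 ≤ (12 * g₂ + 6 * g₁) * (t * η * (Kp * η ^ 2)) / Λ ^ 2 := by gcongr
  have a6 : 2 * g₁ * ((4 + 8 * A₃) * nw ^ 3) / Λ ≤ 2 * g₁ * ((ε₃₀ + ε₃₁ * x) * η ^ 3) / Λ := by gcongr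
  refine ⟨?_, ?_, ?_, ?_, ?_, ?_, ?_⟩
  · rw [hq₁, h𝔮₁]
    have e : η * (2 * g₁ * t / Λ + 1 * (12 * Ba * ζ)) = 2 * g₁ * (t * η) / Λ + 1 * (12 * Ba * (ζ * η)) := by ring
    rw [e]; linarith only [a1, bz₁]
  · rw [hq₂, h𝔮₂]
    have p1 : 4 * g₁ * τw / Λ * z₁ ≤ 4 * g₁ * (t * η) / Λ * (1 * (12 * Ba * (ζ * η))) :=
      mul_le_mul (by gcongr) bz₁ hz₁0 (by positivity)
    have e : η ^ 2 * ((4 * g₂ + 2 * g₁) * t ^ 2 / Λ ^ 2 + 2 * g₁ * Kp / Λ + 4 * g₁ * t / Λ * (1 * (12 * Ba * ζ)) + 1 * ((12 * Ba + 72 * Ba ^ 2) * ζ ^ 2)) =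
        ((4 * g₂ + 2 * g₁) * (t * η) ^ 2 / Λ ^ 2 + 2 * g₁ * (Kp * η ^ 2) / Λ) + 4 * g₁ * (t * η) / Λ * (1 * (12 * Ba * (ζ * η))) +
          1 * ((12 * Ba + 72 * Ba ^ 2) * (ζ * η) ^ 2) := by ring
    rw [e]; linarith only [a2, a3, p1, bz₂]
  · rw [hq₃, h𝔮₃₀, h𝔮₃₁]
    have p1 : ((4 * g₂ + 2 * g₁) * τw ^ 2 / Λ ^ 2 + 2 * g₁ * (Kp * nw ^ 2) / Λ) * z₁ ≤
        ((4 * g₂ + 2 * g₁) * (t * η) ^ 2 / Λ ^ 2 + 2 * g₁ * (Kp * η ^ 2) / Λ) * (1 * (12 * Ba * (ζ * η))) :=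
      mul_le_mul (add_le_add a2 a3) bz₁ hz₁0 (by positivity)
    have p2 : 2 * g₁ * τw / Λ * z₂ ≤ 2 * g₁ * (t * η) / Λ * (1 * ((12 * Ba + 72 * Ba ^ 2) * (ζ * η) ^ 2)) := mul_le_mul a1 bz₂ hz₂0 (by positivity)
    have e : η ^ 3 * ((8 * g₃ + 12 * g₂) * t ^ 3 / Λ ^ 3 + (12 * g₂ + 6 * g₁) * (t * Kp) / Λ ^ 2 + 2 * g₁ * ε₃₀ / Λ +
          3 * (((4 * g₂ + 2 * g₁) * t ^ 2 / Λ ^ 2 + 2 * g₁ * Kp / Λ) * (1 * (12 * Ba * ζ))) + 3 * (2 * g₁ * t / Λ * (1 * ((12 * Ba + 72 * Ba ^ 2) * ζ ^ 2))) +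
          1 * ((12 * Ba + 216 * Ba ^ 2) * ζ ^ 3) + 2 * g₁ * ε₃₁ / Λ * x) =
        ((8 * g₃ + 12 * g₂) * (t * η) ^ 3 / Λ ^ 3 + (12 * g₂ + 6 * g₁) * (t * η * (Kp * η ^ 2)) / Λ ^ 2 + 2 * g₁ * ((ε₃₀ + ε₃₁ * x) * η ^ 3) / Λ) +
          3 * (((4 * g₂ + 2 * g₁) * (t * η) ^ 2 / Λ ^ 2 + 2 * g₁ * (Kp * η ^ 2) / Λ) * (1 * (12 * Ba * (ζ * η)))) +
          3 * (2 * g₁ * (t * η) / Λ * (1 * ((12 * Ba + 72 * Ba ^ 2) * (ζ * η) ^ 2))) + 1 * ((12 * Ba + 216 * Ba ^ 2) * (ζ * η) ^ 3) := by ring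
    rw [e]; linarith only [a4, a5, a6, p1, p2, bz₃]
  · rw [h𝔮₁]; positivity
  · rw [h𝔮₂]; positivity
  · rw [h𝔮₃₀]; positivity
  · rw [h𝔮₃₁]; positivity

/-! ### §2 The scale-form instance -/

section ThinIsoScale

open Classical

variable {L M : ℕ} [NeZero L] [NeZero M] {K : TrigPolyC4v} (Ko : TrigPolyC4v) {A A₃ : ℝ}
  (hA : ∀ p : Momentum, ∀ j ≤ 2, ‖iteratedFDeriv ℝ j (frameShift K) p‖ ≤ A) (hA3 : ∀ p : Momentum, ‖iteratedFDeriv ℝ 3 (frameShift K) p‖ ≤ A₃)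
  {μ e₀ z β : ℝ} (he : 0 < e₀) (hz : 0 < z) (hz1 : z ≤ 1) (hgap : e₀ + A + z ^ 2 < -μ) (h3 : e₀ + A - μ ≤ 3)
  (na nb : ℕ)
  {d : ℝ} (hd1 : ∀ u, |deriv (bgmCutoffSq e₀) u| ≤ d) (hd2 : ∀ u, |iteratedDeriv 2 (bgmCutoffSq e₀) u| ≤ d)
  (hd3 : ∀ u, |iteratedDeriv 3 (bgmCutoffSq e₀) u| ≤ d) (hd4 : ∀ u, |iteratedDeriv 4 (bgmCutoffSq e₀) u| ≤ d)
  {Ba : ℝ} (hB0 : 0 ≤ Ba)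
  (hB : ∀ (i : ℕ), i ≤ 3 → ∀ (n : ℕ) (ω : ℤ) (θ₀ : ℝ) (q w : Fin 2 → ℝ) (t : ℝ) {r₀ : ℝ}, 0 < r₀ →
    r₀ ≤ ‖momToComplex (q + t • w)‖ → |sectorRelAngle θ₀ (q + t • w)| < π →
    ‖iteratedDeriv i (fun t : ℝ => sectorWeightCirc n ω (polarAngle (q + t • w))) t‖ ≤
      (3 : ℕ)! * Ba * ((1 + (sectorWidth n)⁻¹ * (3 : ℕ)!) * ‖momToComplex w‖ / r₀) ^ i)
  -- the piece `ν = e_K − e_{K_o}` in the two-scale class at depth `x`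
  {ν : (Fin 2 → ℝ) → ℝ} (hν : ∀ p, ν p = frameLevel μ K (WithLp.toLp 2 p) - frameLevel μ Ko (WithLp.toLp 2 p)) (hνs : ContDiff ℝ 3 ν)
  {x G₀ G₁ G₂ G₃ ε₃₀ ε₃₁ : ℝ} (hx : 1 ≤ x) (hG₀ : 0 < G₀) (hG₁ : 0 ≤ G₁) (hG₂ : 0 ≤ G₂) (hG₃ : 0 ≤ G₃) (hε₃₀ : 0 ≤ ε₃₀) (hε₃₁ : 0 ≤ ε₃₁)
  (hN₀ : ∀ p, |ν p| ≤ G₀ / x ^ 2) (hN₁ : ∀ p, ‖fderiv ℝ ν p‖ ≤ G₁ / x) (hN₂ : ∀ p, ‖iteratedFDeriv ℝ 2 ν p‖ ≤ G₂)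
  (hN₃ : ∀ p, ‖iteratedFDeriv ℝ 3 ν p‖ ≤ G₃ * x) (hGΛ : G₀ / x ^ 2 ≤ klScale e₀ na) (hA₃x : 4 + 8 * A₃ ≤ ε₃₀ + ε₃₁ * x)
  -- the names (instantiate with `rfl`)
  {κ C₁ B₀x t ε₂ ζ 𝔮₁ 𝔮₂ 𝔮₃₀ 𝔮₃₁ d₁ w₁ d₂ w₂ d₃₀ d₃₁ w₃₀ w₃₁ o₁₀ o₁₁ o₂₀ o₂₁ o₂₂ o₃₀ o₃₁ o₃₂ o₃₃
    R₁₀ R₁₁ R₂₀ R₂₁ R₂₂ R₃₀ R₃₁ R₃₂ R₃₃ r₁₀ r₁₁ r₂₀ r₂₁ r₂₂ r₃₀ r₃₁ r₃₂ r₃₃ : ℝ}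
  (hκ : κ = e₀ ^ 2 / klScale e₀ na ^ 2) (hC₁ : C₁ = d * e₀ ^ 2 / klScale e₀ na ^ 2)
  (hB₀x : B₀x = C₁ * (G₀ / x ^ 2 * (2 * (klScale e₀ na + G₀ / x ^ 2) + G₀ / x ^ 2)))
  (ht : t = 4 + 2 * A) (hε₂ : ε₂ = 4 + 4 * A) (hζ : ζ = (1 + 6 * (sectorWidth na)⁻¹) + (1 + 6 * (sectorWidth nb)⁻¹))
  (h𝔮₁ : 𝔮₁ = 2 * (d * e₀ ^ 2) * t / klScale e₀ nb + 1 * (12 * Ba * ζ))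
  (h𝔮₂ : 𝔮₂ = (4 * (d * e₀ ^ 4) + 2 * (d * e₀ ^ 2)) * t ^ 2 / klScale e₀ nb ^ 2 + 2 * (d * e₀ ^ 2) * (4 + 4 * A) / klScale e₀ nb +
    4 * (d * e₀ ^ 2) * t / klScale e₀ nb * (1 * (12 * Ba * ζ)) + 1 * ((12 * Ba + 72 * Ba ^ 2) * ζ ^ 2))
  (h𝔮₃₀ : 𝔮₃₀ = (8 * (d * e₀ ^ 6) + 12 * (d * e₀ ^ 4)) * t ^ 3 / klScale e₀ nb ^ 3 + (12 * (d * e₀ ^ 4) + 6 * (d * e₀ ^ 2)) * (t * (4 + 4 * A)) / klScale e₀ nb ^ 2 +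
    2 * (d * e₀ ^ 2) * ε₃₀ / klScale e₀ nb +
    3 * (((4 * (d * e₀ ^ 4) + 2 * (d * e₀ ^ 2)) * t ^ 2 / klScale e₀ nb ^ 2 + 2 * (d * e₀ ^ 2) * (4 + 4 * A) / klScale e₀ nb) * (1 * (12 * Ba * ζ))) +
    3 * (2 * (d * e₀ ^ 2) * t / klScale e₀ nb * (1 * ((12 * Ba + 72 * Ba ^ 2) * ζ ^ 2))) + 1 * ((12 * Ba + 216 * Ba ^ 2) * ζ ^ 3))
  (h𝔮₃₁ : 𝔮₃₁ = 2 * (d * e₀ ^ 2) * ε₃₁ / klScale e₀ nb)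
  (hd₁ : d₁ = 4 * klScale e₀ na * t) (hw₁ : w₁ = 2 * (t * G₀ + 2 * klScale e₀ na * G₁ + G₀ * G₁)) (hd₂ : d₂ = 2 * (t ^ 2 + 2 * klScale e₀ na * ε₂))
  (hw₂ : w₂ = 2 * (ε₂ * G₀ + 2 * t * G₁ + 2 * klScale e₀ na * G₂ + G₁ ^ 2 + G₀ * G₂))
  (hd₃₀ : d₃₀ = 2 * (3 * t * ε₂ + 2 * klScale e₀ na * ε₃₀)) (hd₃₁ : d₃₁ = 4 * klScale e₀ na * ε₃₁)
  (hw₃₀ : w₃₀ = 2 * (ε₃₀ * G₀ + ε₃₁ * G₀ + 3 * ε₂ * G₁ + 3 * t * G₂ + 3 * G₁ * G₂ + G₀ * G₃)) (hw₃₁ : w₃₁ = 4 * klScale e₀ na * G₃)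
  (ho₁₀ : o₁₀ = t / klScale e₀ na) (ho₁₁ : o₁₁ = 2 * G₁ / G₀) (ho₂₀ : o₂₀ = ε₂ / klScale e₀ na + G₁ ^ 2 / (klScale e₀ na * G₀))
  (ho₂₁ : o₂₁ = 2 * t * G₁ / (klScale e₀ na * G₀)) (ho₂₂ : o₂₂ = 2 * G₂ / G₀)
  (ho₃₀ : o₃₀ = ε₃₀ / klScale e₀ na) (ho₃₁ : o₃₁ = ε₃₁ / klScale e₀ na + 3 * ε₂ * G₁ / (klScale e₀ na * G₀) + 3 * G₁ * G₂ / (klScale e₀ na * G₀))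
  (ho₃₂ : o₃₂ = 3 * t * G₂ / (klScale e₀ na * G₀)) (ho₃₃ : o₃₃ = 2 * G₃ / G₀)
  (hR₁₀ : R₁₀ = κ * (d₁ + w₁) + o₁₀) (hR₁₁ : R₁₁ = o₁₁)
  (hR₂₀ : R₂₀ = κ ^ 2 * (d₁ + w₁) ^ 2 + κ * (o₁₀ * (2 * d₁ + w₁)) + κ * (d₂ + w₂) + o₂₀) (hR₂₁ : R₂₁ = κ * (o₁₁ * (2 * d₁ + w₁)) + o₂₁)
  (hR₂₂ : R₂₂ = o₂₂)
  (hR₃₀ : R₃₀ = κ ^ 3 * (d₁ + w₁) ^ 3 + κ ^ 2 * (o₁₀ * (3 * d₁ ^ 2 + 3 * d₁ * w₁ + w₁ ^ 2)) +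
    3 * (κ ^ 2 * ((d₁ + w₁) * (d₂ + w₂)) + κ * (d₁ * o₂₀ + o₁₀ * d₂ + o₁₀ * w₂)) + κ * (d₃₀ + w₃₀) + o₃₀)
  (hR₃₁ : R₃₁ = κ ^ 2 * (o₁₁ * (3 * d₁ ^ 2 + 3 * d₁ * w₁ + w₁ ^ 2)) + 3 * (κ * (d₁ * o₂₁ + o₁₁ * d₂ + o₁₁ * w₂)) + κ * (d₃₁ + w₃₁) + o₃₁)
  (hR₃₂ : R₃₂ = 3 * (κ * (d₁ * o₂₂)) + o₃₂) (hR₃₃ : R₃₃ = o₃₃)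
  (hr₁₀ : r₁₀ = R₁₀ + 𝔮₁) (hr₁₁ : r₁₁ = R₁₁) (hr₂₀ : r₂₀ = R₂₀ + 2 * R₁₀ * 𝔮₁ + 𝔮₂) (hr₂₁ : r₂₁ = R₂₁ + 2 * R₁₁ * 𝔮₁) (hr₂₂ : r₂₂ = R₂₂)
  (hr₃₀ : r₃₀ = R₃₀ + 3 * R₂₀ * 𝔮₁ + 3 * R₁₀ * 𝔮₂ + 𝔮₃₀) (hr₃₁ : r₃₁ = R₃₁ + 3 * R₂₁ * 𝔮₁ + 3 * R₁₁ * 𝔮₂ + 𝔮₃₁)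
  (hr₃₂ : r₃₂ = R₃₂ + 3 * R₂₂ * 𝔮₁) (hr₃₃ : r₃₃ = R₃₃)

include hA hA3 he hz hz1 hgap h3 hd1 hd2 hd3 hd4 hB0 hB hν hνs hx hG₀ hG₁ hG₂ hG₃ hε₃₀ hε₃₁ hN₀ hN₁ hN₂ hN₃ hGΛ hA₃x hκ hC₁ hB₀x ht hε₂ hζ h𝔮₁ h𝔮₂ h𝔮₃₀ h𝔮₃₁
  hd₁ hw₁ hd₂ hw₂ hd₃₀ hd₃₁ hw₃₀ hw₃₁ ho₁₀ ho₁₁ ho₂₀ ho₂₁ ho₂₂ ho₃₀ ho₃₁ ho₃₂ ho₃₃ hR₁₀ hR₁₁ hR₂₀ hR₂₁ hR₂₂ hR₃₀ hR₃₁ hR₃₂ hR₃₃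
  hr₁₀ hr₁₁ hr₂₀ hr₂₁ hr₂₂ hr₃₀ hr₃₁ hr₃₂ hr₃₃ in
set_option maxHeartbeats 4000000 in
/-- **Space differences of the THIN increment pair in relative scale form, every admissible integer step** (see the module docstring).
[cite: BenfattoGiulianiMastropietro2006, §2.5 Lemma 2.2 (2.53)–(2.55), §3 (3.2)–(3.8)] -/
theorem norm_fwdDiff_iter_thinIncrPair_scaleIso_le (ωa : Fin (sectorCount na)) (ωb : Fin (sectorCount nb)) (Gs : TorusSite 1 (2 * M) × TorusSite 2 L → ℂ)
    (hGsdef : Gs = fun q => klAnisoFamily L M β μ Ko e₀ na ωa (⟨(q.1 0).val, ZMod.val_lt (q.1 0)⟩, q.2) *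
        klAnisoFamily L M β μ K e₀ nb ωb (⟨(q.1 0).val, ZMod.val_lt (q.1 0)⟩, q.2) -
      klAnisoFamily L M β μ K e₀ na ωa (⟨(q.1 0).val, ZMod.val_lt (q.1 0)⟩, q.2) *
        klAnisoFamily L M β μ K e₀ nb ωb (⟨(q.1 0).val, ZMod.val_lt (q.1 0)⟩, q.2))
    (u : Fin 2 → ℤ) (hu : ∀ j, 3 * |2 * π / L| * |(u j : ℝ)| ≤ z) (q : TorusSite 1 (2 * M) × TorusSite 2 L) :
    ‖(fwdDiff ((0 : TorusSite 1 (2 * M)), (fun j => ((u j : ℤ) : ZMod L)))) Gs q‖ ≤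
        B₀x * (‖(WithLp.toLp 2 (fun j => 2 * π / L * (u j : ℝ)) : EuclideanSpace ℝ (Fin 2))‖ * (r₁₀ + r₁₁ * x)) ∧
    ‖((fwdDiff ((0 : TorusSite 1 (2 * M)), (fun j => ((u j : ℤ) : ZMod L))))^[2] Gs) q‖ ≤
        B₀x * (‖(WithLp.toLp 2 (fun j => 2 * π / L * (u j : ℝ)) : EuclideanSpace ℝ (Fin 2))‖ ^ 2 * (r₂₀ + r₂₁ * x + r₂₂ * x ^ 2)) ∧
    ‖((fwdDiff ((0 : TorusSite 1 (2 * M)), (fun j => ((u j : ℤ) : ZMod L))))^[3] Gs) q‖ ≤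
        B₀x * (‖(WithLp.toLp 2 (fun j => 2 * π / L * (u j : ℝ)) : EuclideanSpace ℝ (Fin 2))‖ ^ 3 * (r₃₀ + r₃₁ * x + r₃₂ * x ^ 2 + r₃₃ * x ^ 3)) ∧
    (0 ≤ r₁₀ ∧ 0 ≤ r₁₁ ∧ 0 ≤ r₂₀ ∧ 0 ≤ r₂₁ ∧ 0 ≤ r₂₂ ∧ 0 ≤ r₃₀ ∧ 0 ≤ r₃₁ ∧ 0 ≤ r₃₂ ∧ 0 ≤ r₃₃) := by
  have hL : (0 : ℝ) < L := Nat.cast_pos.2 (Nat.pos_of_ne_zero (NeZero.ne L))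
  have hπ := Real.pi_pos
  have hΛ : 0 < klScale e₀ na := by rw [klScale]; positivity
  have hΛb : 0 < klScale e₀ nb := by rw [klScale]; positivity
  have hA0 : 0 ≤ A := (norm_nonneg _).trans (hA 0 0 (by norm_num))
  have hd0 : 0 ≤ d := (abs_nonneg _).trans (hd1 0)
  have hx0 : 0 < x := lt_of_lt_of_le one_pos hx
  -- the objects: angular factor, increment symbol, identification
  obtain ⟨Z, hZdef⟩ : ∃ Z : (Fin 2 → ℝ) → ℝ, Z = fun p => gnCutoff ((π + z) ^ 2 / π ^ 2) ((π + z) ^ 2) (p 0 ^ 2) * gnCutoff ((π + z) ^ 2 / π ^ 2) ((π + z) ^ 2) (p 1 ^ 2) *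
    ((radialCutoffC (1 / 2) (momToComplex p) * sectorWeightCirc na ((ωa : ℕ) : ℤ) (polarAngle p)) *
      (radialCutoffC (1 / 2) (momToComplex p) * sectorWeightCirc nb ((ωb : ℕ) : ℤ) (polarAngle p))) := ⟨_, rfl⟩
  have hZ : ∀ p, Z p = gnCutoff ((π + z) ^ 2 / π ^ 2) ((π + z) ^ 2) (p 0 ^ 2) * gnCutoff ((π + z) ^ 2 / π ^ 2) ((π + z) ^ 2) (p 1 ^ 2) *
    ((radialCutoffC (1 / 2) (momToComplex p) * sectorWeightCirc na ((ωa : ℕ) : ℤ) (polarAngle p)) *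
      (radialCutoffC (1 / 2) (momToComplex p) * sectorWeightCirc nb ((ωb : ℕ) : ℤ) (polarAngle p))) := fun p => by rw [hZdef]
  obtain ⟨Φ, hΦdef⟩ : ∃ Φ : ℝ × (Fin 2 → ℝ) → ℂ, Φ = fun y => (((bgmCutoffSq e₀ ((16 : ℝ) ^ na * (y.1 ^ 2 + (frameLevel μ K (WithLp.toLp 2 y.2) - ν y.2) ^ 2)) -
      bgmCutoffSq e₀ ((16 : ℝ) ^ na * (y.1 ^ 2 + frameLevel μ K (WithLp.toLp 2 y.2) ^ 2))) *
      (bgmCutoffSq e₀ ((16 : ℝ) ^ nb * (y.1 ^ 2 + frameLevel μ K (WithLp.toLp 2 y.2) ^ 2)) * Z y.2) : ℝ) : ℂ) := ⟨_, rfl⟩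
  have hΦ : ∀ k₀ p, Φ (k₀, p) = (((bgmCutoffSq e₀ ((16 : ℝ) ^ na * (k₀ ^ 2 + (frameLevel μ K (WithLp.toLp 2 p) - ν p) ^ 2)) -
      bgmCutoffSq e₀ ((16 : ℝ) ^ na * (k₀ ^ 2 + frameLevel μ K (WithLp.toLp 2 p) ^ 2))) *
      (bgmCutoffSq e₀ ((16 : ℝ) ^ nb * (k₀ ^ 2 + frameLevel μ K (WithLp.toLp 2 p) ^ 2)) * Z p) : ℝ) : ℂ) := fun k₀ p => by rw [hΦdef]
  have hGsΦ : ∀ q, Gs q = Φ (π * (1 - 2 * M) / β + 2 * π / β * (((q.1 0).val : ℕ) : ℝ), fun j => 2 * π / L * (((q.2 j).valMinAbs : ℤ) : ℝ)) := by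
    intro q'; rw [hGsdef]
    exact klAnisoIncr_mul_klAniso_eq_symbol Ko hA he hz h3 ωa ωb hZ hν hΦ q'
  -- the step and its norms
  set w : Fin 2 → ℝ := fun j => 2 * π / L * (u j : ℝ) with hw
  set η : ℝ := ‖(WithLp.toLp 2 (fun j => 2 * π / L * (u j : ℝ)) : EuclideanSpace ℝ (Fin 2))‖ with hηdef
  have hη0 : 0 ≤ η := norm_nonneg _
  have hwη : ‖w‖ ≤ η := by
    rw [hηdef, norm_toLp_latticeStep]
    refine (pi_norm_le_iff_of_nonneg (by positivity)).2 fun i => ?_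
    rw [hw, Real.norm_eq_abs, abs_mul, abs_of_pos (by positivity : (0:ℝ) < 2 * π / L)]
    refine mul_le_mul_of_nonneg_left (Real.abs_le_sqrt ?_) (by positivity)
    fin_cases i
    · exact le_add_of_nonneg_right (sq_nonneg _)
    · exact le_add_of_nonneg_left (sq_nonneg _)
  have hmc : ‖momToComplex w‖ = η := by
    rw [hηdef, ← norm_momToComplex_ofLp]
  -- the instance at the step `u`, exact brackets
  obtain ⟨h₁, h₂, h₃⟩ := norm_fwdDiff_iter_space_thinIncrPair_le hA hA3 he hz hz1 hgap h3 na nb hd1 hd2 hd3 hd4 hB0 hB hZ hνs hN₀ hN₁ hN₂ hN₃ hΦ hGsΦ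
    u hu hw rfl rfl rfl rfl rfl rfl rfl rfl rfl rfl rfl rfl rfl rfl rfl rfl rfl rfl rfl rfl rfl rfl rfl rfl rfl rfl rfl rfl rfl rfl rfl rfl q
  -- the co-factor jets in scale form
  have hζ0 : 0 ≤ ζ := by rw [hζ]; have := sectorWidth_pos na; have := sectorWidth_pos nb; positivity
  have hzDa : (1 + 6 * (sectorWidth na)⁻¹) * ‖momToComplex w‖ ≤ ζ * η := by
    rw [hmc, hζ]
    have h1 : 0 ≤ 1 + 6 * (sectorWidth nb)⁻¹ := by have := sectorWidth_pos nb; positivity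
    exact mul_le_mul_of_nonneg_right (le_add_of_nonneg_right h1) hη0
  have hzDb : (1 + 6 * (sectorWidth nb)⁻¹) * ‖momToComplex w‖ ≤ ζ * η := by
    rw [hmc, hζ]
    have h1 : 0 ≤ 1 + 6 * (sectorWidth na)⁻¹ := by have := sectorWidth_pos na; positivity
    exact mul_le_mul_of_nonneg_right (le_add_of_nonneg_left h1) hη0
  obtain ⟨hq₁', hq₂', hq₃', h𝔮₁0, h𝔮₂0, h𝔮₃₀0, h𝔮₃₁0⟩ := thinIncr_cofactor_scale_le (g₁ := d * e₀ ^ 2) (g₂ := d * e₀ ^ 4) (g₃ := d * e₀ ^ 6)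
    (Λ := klScale e₀ nb) (Kp := 4 + 4 * A) (A₃ := A₃) (τw := (4 + 2 * A) * ‖w‖) (nw := ‖w‖)
    (zD₁ := (1 + 6 * (sectorWidth na)⁻¹) * ‖momToComplex w‖) (zD₂ := (1 + 6 * (sectorWidth nb)⁻¹) * ‖momToComplex w‖)
    (Ba := Ba) (t := t) (η := η) (ζ := ζ) (ε₃₀ := ε₃₀) (ε₃₁ := ε₃₁) (x := x)
    (by positivity) (by positivity) (by positivity) hΛb (by positivity) hB0 (by positivity) (norm_nonneg _)
    (by have := sectorWidth_pos na; positivity) (by have := sectorWidth_pos nb; positivity)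
    (by rw [ht]; positivity) hζ0 hε₃₀ hε₃₁ hx
    (by rw [ht]; exact mul_le_mul_of_nonneg_left hwη (by positivity)) hwη hzDa hzDb hA₃x
    rfl rfl rfl rfl rfl rfl h𝔮₁ h𝔮₂ h𝔮₃₀ h𝔮₃₁
  have ht0 : 0 ≤ t := by rw [ht]; positivity
  -- nonnegativity of the co-factor's actual jets
  have hq₁0 : 0 ≤ 2 * (d * e₀ ^ 2) * ((4 + 2 * A) * ‖w‖) / klScale e₀ nb * 1 +
      1 * (6 * Ba * ((1 + 6 * (sectorWidth na)⁻¹) * ‖momToComplex w‖ + (1 + 6 * (sectorWidth nb)⁻¹) * ‖momToComplex w‖)) := by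
    have := sectorWidth_pos na; have := sectorWidth_pos nb; positivity
  have hq₂0 : 0 ≤ ((4 * (d * e₀ ^ 4) + 2 * (d * e₀ ^ 2)) * ((4 + 2 * A) * ‖w‖) ^ 2 / klScale e₀ nb ^ 2 + 2 * (d * e₀ ^ 2) * ((4 + 4 * A) * ‖w‖ ^ 2) / klScale e₀ nb) * 1 +
      4 * (d * e₀ ^ 2) * ((4 + 2 * A) * ‖w‖) / klScale e₀ nb *
        (6 * Ba * ((1 + 6 * (sectorWidth na)⁻¹) * ‖momToComplex w‖ + (1 + 6 * (sectorWidth nb)⁻¹) * ‖momToComplex w‖)) +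
      1 * (6 * Ba * (((1 + 6 * (sectorWidth na)⁻¹) * ‖momToComplex w‖) ^ 2 + ((1 + 6 * (sectorWidth nb)⁻¹) * ‖momToComplex w‖) ^ 2) +
        72 * Ba ^ 2 * (((1 + 6 * (sectorWidth na)⁻¹) * ‖momToComplex w‖) * ((1 + 6 * (sectorWidth nb)⁻¹) * ‖momToComplex w‖))) := by
    have := sectorWidth_pos na; have := sectorWidth_pos nb; positivity
  -- the algebra
  have hκ0 : 0 ≤ κ := by rw [hκ]; positivity
  have hA30 : 0 ≤ A₃ := (norm_nonneg _).trans (hA3 0)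
  obtain ⟨c₁, c₂, c₃, hnn⟩ := incrPair_space_rel_scale_le (Λ := klScale e₀ na) (E₀ := klScale e₀ na + G₀ / x ^ 2) (t := t) (ε₂ := ε₂) (ε₃₀ := ε₃₀) (ε₃₁ := ε₃₁)
    (G₀ := G₀) (G₁ := G₁) (G₂ := G₂) (G₃ := G₃) (η := η) (x := x) (κ := κ) (C₁ := d * e₀ ^ 2 / klScale e₀ na ^ 2)
    (C₂ := d * e₀ ^ 4 / klScale e₀ na ^ 4) (C₃ := d * e₀ ^ 6 / klScale e₀ na ^ 6) (C₄ := d * e₀ ^ 8 / klScale e₀ na ^ 8)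
    (E₁ := (4 + 2 * A) * ‖w‖) (E₂ := (4 + 4 * A) * ‖w‖ ^ 2) (E₃ := (4 + 8 * A₃) * ‖w‖ ^ 3)
    (P₀ := G₀ / x ^ 2) (P₁ := G₁ / x * ‖w‖) (P₂ := G₂ * ‖w‖ ^ 2) (P₃ := G₃ * x * ‖w‖ ^ 3)
    hΛ (le_add_of_nonneg_right (by positivity)) (by linarith only [hGΛ]) ht0 (by rw [hε₂]; positivity) hε₃₀ hε₃₁ hG₀ hG₁ hG₂ hG₃ hη0 hx hκ0 (by positivity)
    (by positivity) (by positivity) (by positivity) (by positivity) (by positivity) (by positivity)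
    (by rw [ht]; exact mul_le_mul_of_nonneg_left hwη (by positivity))
    (by rw [hε₂]; exact mul_le_mul_of_nonneg_left (pow_le_pow_left₀ (norm_nonneg _) hwη 2) (by positivity))
    (mul_le_mul hA₃x (pow_le_pow_left₀ (norm_nonneg _) hwη 3) (by positivity) (by positivity))
    rfl (mul_le_mul_of_nonneg_left hwη (by positivity)) (mul_le_mul_of_nonneg_left (pow_le_pow_left₀ (norm_nonneg _) hwη 2) hG₂)
    (mul_le_mul_of_nonneg_left (pow_le_pow_left₀ (norm_nonneg _) hwη 3) (by positivity))
    (by rw [hκ]; field_simp) (by rw [hκ]; field_simp) (by rw [hκ]; field_simp)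
    rfl rfl rfl rfl rfl rfl rfl rfl rfl rfl rfl h₁ h₂ h₃ hq₁0 hq₂0 hq₁' hq₂' hq₃' h𝔮₁0 h𝔮₂0 h𝔮₃₀0 h𝔮₃₁0
    hd₁ hw₁ hd₂ hw₂ hd₃₀ hd₃₁ hw₃₀ hw₃₁ ho₁₀ ho₁₁ ho₂₀ ho₂₁ ho₂₂ ho₃₀ ho₃₁ ho₃₂ ho₃₃ hR₁₀ hR₁₁ hR₂₀ hR₂₁ hR₂₂ hR₃₀ hR₃₁ hR₃₂ hR₃₃
    hr₁₀ hr₁₁ hr₂₀ hr₂₁ hr₂₂ hr₃₀ hr₃₁ hr₃₂ hr₃₃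
  rw [← hC₁, ← hB₀x] at c₁ c₂ c₃
  exact ⟨c₁, c₂, c₃, hnn⟩

end ThinIsoScale

end Summit.HubbardSuperconductivity.HubbardSuperconductivity.Theorems.TorusFourierL2

end
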